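import Literature.NumberTheory.Sieve.AletheiaZomleferFukshanskyGarcia2020ConjFProofs

/-!
# Bounded cofactors of `n² + 1`: every rung is an instance of Conjecture F

Soloist artefact (family `parity`, seat `solo-Parity-informed`, session 3), companion to
`SoloInformedChebyshevHooleyRows` / `…Top` / `…Level` (the Chebyshev–Hooley ladder).

The greatest-prime-factor programme on `n² + 1` (Chebyshev, Markov, Hooley,
Deshouillers–Iwaniec, de la Bretèche–Drappeau, Merikoski, Grimmelt–Merikoski:
`P⁺(n² + 1) > n^{1.312}` infinitely often) climbs towards the exponent `2`; granting every
asymptotic rung it can at best produce `n² + 1 = m · p` with a cofactor `m ≤ n^{o(1)}`.  This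
file records, as kernel theorems, why the apparently modest next step — a BOUNDED cofactor,
`n² + 1 = m · p` with `m ≤ M` for infinitely many `n` — is not an intermediate statement at all
but a finite disjunction of instances of the conjunct itself:

* `cofactor_identity`: for `m ∣ ν² + 1`,
  `(mY + ν)² + 1 = m · (mY² + 2νY + (ν² + 1)/m)`;
* `prime_quadratic_of_cofactor`: conversely `(mY + ν)² + 1 = m · p` forces `m ∣ ν² + 1` and
  `p = mY² + 2νY + (ν² + 1)/m`;
* `cofactorRung_infinite_iff`: `{n : n² + 1 = m · p, p prime, 1 ≤ m ≤ M}` is infinite iff for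
  some `1 ≤ m ≤ M` and some root `ν` of `ν² ≡ −1 (mod m)`, `0 ≤ ν < m`, the integer quadratic
  `g_{m,ν}(Y) = mY² + 2νY + (ν² + 1)/m` (discriminant `−4`) takes infinitely many prime values;
* `isBatemanHornSystem_cofactorPoly`: every such `g_{m,ν}` satisfies the hypotheses of
  Hardy–Littlewood's Conjecture F / Bateman–Horn (`gcd = 1`, no fixed prime divisor,
  irreducible), via the tree's `Literature.NumberTheory.Sieve.isBatemanHornSystem_quadratic`
  (Aletheia-Zomlefer–Fukshansky–Garcia 2020, §6.5);
* `exists_batemanHornSystem_of_cofactorRung_infinite`: hence an infinite bounded-cofactor rung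
  yields a quadratic Bateman–Horn system with infinitely many prime values — of which none is
  known ("without the Bateman–Horn conjecture or one of its weaker relatives, we do not even know
  if any quadratic polynomial produces infinitely many primes", AFG 2020 §6.4);
* `cofactor_le_iff`: the rung in greatest-prime-factor form, `P⁺(n² + 1) · M ≥ n² + 1`;
* `cofactorRung_infinite_of_conjF`: the converse sanity direction — Conjecture F (indeed its
  instance `(a, b, c) = (1, 0, 1)`, Landau) gives every rung.

All statements are over Mathlib and the tree's `Literature.NumberTheory.Sieve` declarations; no
new definitions.

References: S. L. Aletheia-Zomlefer, L. Fukshansky, S. R. Garcia, Expo. Math. 38 (2020),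
arXiv:1807.08899, §6.4–6.5; L. Grimmelt, J. Merikoski, arXiv:2505.00493, Thm 1.1;
J.-M. Deshouillers, H. Iwaniec, Ann. Inst. Fourier 32 (1982).
-/

namespace Summit.Parity.BatemanHorn.Theorems

open Polynomial Literature.NumberTheory.Sieve

/-! ### The identity behind the rung -/

/-- For `m ∣ ν² + 1`: `(mY + ν)² + 1 = m · (mY² + 2νY + (ν² + 1)/m)`. [folklore] -/
theorem cofactor_identity {m ν : ℕ} (h : m ∣ ν ^ 2 + 1) (Y : ℕ) :
    (m * Y + ν) ^ 2 + 1 = m * (m * Y ^ 2 + 2 * ν * Y + (ν ^ 2 + 1) / m) := by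
  obtain ⟨q, hq⟩ := h
  have hm : 0 < m := Nat.pos_of_ne_zero (by rintro rfl; simp at hq)
  rw [hq, Nat.mul_div_cancel_left q hm]
  calc (m * Y + ν) ^ 2 + 1 = m * (m * Y ^ 2 + 2 * ν * Y) + (ν ^ 2 + 1) := by ring
    _ = m * (m * Y ^ 2 + 2 * ν * Y) + m * q := by rw [hq]
    _ = m * (m * Y ^ 2 + 2 * ν * Y + q) := by ring

/-- Conversely, a cofactorisation `(mY + ν)² + 1 = m · p` forces `m ∣ ν² + 1` and identifies
`p` as the value at `Y` of the quadratic `mY² + 2νY + (ν² + 1)/m`. [folklore] -/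
theorem prime_quadratic_of_cofactor {m Y ν p : ℕ} (hm : 0 < m)
    (h : (m * Y + ν) ^ 2 + 1 = m * p) :
    m ∣ ν ^ 2 + 1 ∧ m * Y ^ 2 + 2 * ν * Y + (ν ^ 2 + 1) / m = p := by
  have key : m * (m * Y ^ 2 + 2 * ν * Y) + (ν ^ 2 + 1) = m * p := by rw [← h]; ring
  have hdvd : m ∣ ν ^ 2 + 1 := by
    have : m ∣ m * (m * Y ^ 2 + 2 * ν * Y) + (ν ^ 2 + 1) := by rw [key]; exact Dvd.intro p rfl
    exact (Nat.dvd_add_right (Dvd.intro _ rfl)).mp this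
  refine ⟨hdvd, ?_⟩
  obtain ⟨q, hq⟩ := hdvd
  rw [hq, Nat.mul_div_cancel_left q hm]
  rw [hq, ← Nat.mul_add] at key
  exact Nat.eq_of_mul_eq_mul_left hm key

/-- The rung in greatest-prime-factor form: `n² + 1 = m · p` with `1 ≤ m ≤ M` for some prime `p`
iff some prime divisor `p` of `n² + 1` has `n² + 1 ≤ M · p` (i.e. `P⁺(n² + 1) ≥ (n² + 1)/M`).
[folklore] -/
theorem cofactor_le_iff (n M : ℕ) :
    (∃ m p : ℕ, 0 < m ∧ m ≤ M ∧ p.Prime ∧ n ^ 2 + 1 = m * p) ↔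
      ∃ p : ℕ, p.Prime ∧ p ∣ n ^ 2 + 1 ∧ n ^ 2 + 1 ≤ M * p := by
  constructor
  · rintro ⟨m, p, -, hmM, hp, h⟩
    exact ⟨p, hp, ⟨m, by rw [h, Nat.mul_comm]⟩, h ▸ Nat.mul_le_mul_right p hmM⟩
  · rintro ⟨p, hp, hpd, hle⟩
    refine ⟨(n ^ 2 + 1) / p, p, ?_, ?_, hp, (Nat.div_mul_cancel hpd).symm⟩
    · exact Nat.div_pos (Nat.le_of_dvd (Nat.succ_pos _) hpd) hp.pos
    · exact Nat.div_le_of_le_mul (by rwa [Nat.mul_comm] at hle)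

/-! ### The rung is a finite disjunction of prime-producing quadratics -/

/-- **Bounded cofactor ⟺ a Conjecture-F instance.**  The set of `n` with `n² + 1 = m · p`,
`p` prime, `1 ≤ m ≤ M`, is infinite iff for some `1 ≤ m ≤ M` and some `ν < m` with
`m ∣ ν² + 1` the quadratic `mY² + 2νY + (ν² + 1)/m` takes infinitely many prime values
(`n = mY + ν`).  [folklore; the pigeonhole over the finitely many pairs `(m, ν)`] -/
theorem cofactorRung_infinite_iff (M : ℕ) :
    {n : ℕ | ∃ m p : ℕ, 0 < m ∧ m ≤ M ∧ p.Prime ∧ n ^ 2 + 1 = m * p}.Infinite ↔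
      ∃ m ν : ℕ, 0 < m ∧ m ≤ M ∧ ν < m ∧ m ∣ ν ^ 2 + 1 ∧
        {Y : ℕ | (m * Y ^ 2 + 2 * ν * Y + (ν ^ 2 + 1) / m).Prime}.Infinite := by
  constructor
  · intro hinf
    by_contra hfin
    have hfinite : (⋃ q ∈ (↑(Finset.Icc 1 M ×ˢ Finset.range M) : Set (ℕ × ℕ)),
        (fun Y : ℕ ↦ q.1 * Y + q.2) ''
          {Y : ℕ | q.1 ∣ q.2 ^ 2 + 1 ∧ q.2 < q.1 ∧
            (q.1 * Y ^ 2 + 2 * q.2 * Y + (q.2 ^ 2 + 1) / q.1).Prime}).Finite := by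
      refine Set.Finite.biUnion (Finset.finite_toSet _) fun q hq ↦ Set.Finite.image _ ?_
      simp only [Finset.coe_product, Set.mem_prod, Finset.mem_coe, Finset.mem_Icc,
        Finset.mem_range] at hq
      by_contra hq'
      obtain ⟨Y₀, hY₀⟩ := (Set.not_finite.mp hq').nonempty
      exact hfin ⟨q.1, q.2, hq.1.1, hq.1.2, hY₀.2.1, hY₀.1,
        (Set.not_finite.mp hq').mono fun Y hY ↦ hY.2.2⟩
    refine (hfinite.subset ?_).not_infinite hinf
    rintro n ⟨m, p, hm, hmM, hp, hn⟩
    have hdecomp : m * (n / m) + n % m = n := Nat.div_add_mod n m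
    have hνm : n % m < m := Nat.mod_lt n hm
    obtain ⟨hd, hval⟩ := prime_quadratic_of_cofactor (Y := n / m) (ν := n % m) (p := p) hm
      (by rw [hdecomp]; exact hn)
    simp only [Set.mem_iUnion, Set.mem_image, Set.mem_setOf_eq, Finset.coe_product,
      Set.mem_prod, Finset.mem_coe, Finset.mem_Icc, Finset.mem_range, exists_prop]
    exact ⟨(m, n % m), ⟨⟨hm, hmM⟩, lt_of_lt_of_le hνm hmM⟩, n / m, ⟨hd, hνm, hval ▸ hp⟩,
      hdecomp⟩
  · rintro ⟨m, ν, hm, hmM, hνm, hd, hinf⟩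
    have hinj : Set.InjOn (fun Y : ℕ ↦ m * Y + ν) {Y : ℕ |
        (m * Y ^ 2 + 2 * ν * Y + (ν ^ 2 + 1) / m).Prime} :=
      fun a _ b _ (h : m * a + ν = m * b + ν) ↦
        Nat.eq_of_mul_eq_mul_left hm (Nat.add_right_cancel h)
    refine (hinf.image hinj).mono ?_
    rintro _ ⟨Y, hY, rfl⟩
    exact ⟨m, _, hm, hmM, hY, cofactor_identity hd Y⟩

/-! ### Each rung quadratic satisfies the hypotheses of Conjecture F -/

/-- `4 ∤ ν² + 1`. [folklore] -/
theorem not_four_dvd_sq_add_one (ν : ℕ) : ¬ 4 ∣ ν ^ 2 + 1 := by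
  intro h
  obtain ⟨k, hk | hk⟩ := Nat.even_or_odd' ν
  · have h' : 4 ∣ 4 * k ^ 2 + 1 := by rw [hk] at h; convert h using 1; ring
    have : 4 ∣ 1 := (Nat.dvd_add_right (Dvd.intro _ rfl)).mp h'
    omega
  · have h' : 4 ∣ 4 * (k ^ 2 + k) + 2 := by rw [hk] at h; convert h using 1; ring
    have : 4 ∣ 2 := (Nat.dvd_add_right (Dvd.intro _ rfl)).mp h'
    omega

/-- For `ν² + 1 = m · q`: `gcd(m, 2ν, q) = 1` (content of the rung quadratic). [folklore] -/
theorem gcd_cofactorPoly_eq_one {m ν q : ℕ} (hq : ν ^ 2 + 1 = m * q) :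
    Nat.gcd (Nat.gcd m (2 * ν)) q = 1 := by
  obtain ⟨d, hd⟩ : ∃ d, Nat.gcd (Nat.gcd m (2 * ν)) q = d := ⟨_, rfl⟩
  rw [hd]
  have hm : d ∣ m := hd ▸ (Nat.gcd_dvd_left _ _).trans (Nat.gcd_dvd_left _ _)
  have hν : d ∣ 2 * ν := hd ▸ (Nat.gcd_dvd_left _ _).trans (Nat.gcd_dvd_right _ _)
  have hq' : d ∣ q := hd ▸ Nat.gcd_dvd_right _ _
  have h4 : d ∣ 4 := by
    have hA : d ∣ (2 * ν) ^ 2 + 4 := by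
      rw [show (2 * ν) ^ 2 + 4 = 4 * (m * q) by rw [← hq]; ring]
      exact (hm.mul_right q).mul_left 4
    exact (Nat.dvd_add_right (dvd_pow hν two_ne_zero)).mp hA
  have hodd : ¬ 2 ∣ d := by
    intro h2
    have : 4 ∣ ν ^ 2 + 1 := hq ▸ Nat.mul_dvd_mul (h2.trans hm) (h2.trans hq')
    exact not_four_dvd_sq_add_one ν this
  have hdle : d ≤ 4 := Nat.le_of_dvd (by norm_num) h4
  interval_cases d <;> omega

/-- The discriminant of the rung quadratic is `−4`: `(2ν)² − 4 m q = −4`. [folklore] -/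
theorem disc_cofactorPoly {m ν q : ℕ} (hq : ν ^ 2 + 1 = m * q) :
    ((2 * ν : ℕ) : ℤ) ^ 2 - 4 * (m : ℤ) * (q : ℤ) = -4 := by
  have : ((ν ^ 2 + 1 : ℕ) : ℤ) = ((m * q : ℕ) : ℤ) := by rw [hq]
  push_cast at this ⊢
  linear_combination (4 : ℤ) * this

/-- **Every rung quadratic is a Bateman–Horn system.**  For `1 ≤ m`, `m ∣ ν² + 1`, the
polynomial `g_{m,ν} = m X² + 2ν X + (ν² + 1)/m ∈ ℤ[X]` satisfies the hypotheses of Conjecture F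
(`a > 0`, `gcd(a,b,c) = 1`, `a + b`, `c` not both even, `Δ = −4` not a square), hence
`IsBatemanHornSystem ![g_{m,ν}]` by `isBatemanHornSystem_quadratic`
(Aletheia-Zomlefer–Fukshansky–Garcia 2020, §6.5). [cite: AletheiaZomleferFukshanskyGarcia2020, §6.5] -/
theorem isBatemanHornSystem_cofactorPoly {m ν : ℕ} (hm : 0 < m) (hd : m ∣ ν ^ 2 + 1) :
    IsBatemanHornSystem
      ![C (m : ℤ) * X ^ 2 + C ((2 * ν : ℕ) : ℤ) * X + C (((ν ^ 2 + 1) / m : ℕ) : ℤ)] := by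
  obtain ⟨q, hq⟩ := hd
  have hqm : (ν ^ 2 + 1) / m = q := by rw [hq, Nat.mul_div_cancel_left q hm]
  rw [hqm]
  refine isBatemanHornSystem_quadratic (by exact_mod_cast hm) ?_ ?_ ?_
  · rw [Int.gcd_natCast_natCast, Int.gcd_natCast_natCast]
    exact gcd_cofactorPoly_eq_one hq
  · rintro ⟨h1, h2⟩
    rw [← Nat.cast_add, Int.even_coe_nat] at h1
    rw [Int.even_coe_nat] at h2
    have h2m : 2 ∣ m := by
      have : 2 ∣ m + 2 * ν := even_iff_two_dvd.mp h1
      exact (Nat.dvd_add_left (Dvd.intro ν rfl)).mp this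
    exact not_four_dvd_sq_add_one ν (hq ▸ Nat.mul_dvd_mul h2m (even_iff_two_dvd.mp h2))
  · rw [disc_cofactorPoly hq]
    rintro ⟨r, hr⟩
    nlinarith [mul_self_nonneg r]

/-- The value of the rung quadratic at a natural number. [folklore] -/
theorem eval_cofactorPoly (m ν q t : ℕ) :
    (C (m : ℤ) * X ^ 2 + C ((2 * ν : ℕ) : ℤ) * X + C (q : ℤ)).eval (t : ℤ) =
      ((m * t ^ 2 + 2 * ν * t + q : ℕ) : ℤ) := by
  simp only [eval_add, eval_mul, eval_C, eval_pow, eval_X]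
  push_cast
  ring

/-- **Bounded cofactor ⟹ some quadratic Bateman–Horn system takes infinitely many prime values**
(with leading coefficient `≤ M` and discriminant `−4`).  No single instance of the conclusion is
known (AFG 2020, §6.4); the instance `m = 1` is Landau's problem. [folklore] -/
theorem exists_batemanHornSystem_of_cofactorRung_infinite {M : ℕ}
    (h : {n : ℕ | ∃ m p : ℕ, 0 < m ∧ m ≤ M ∧ p.Prime ∧ n ^ 2 + 1 = m * p}.Infinite) :
    ∃ f : ℤ[X], IsBatemanHornSystem ![f] ∧ f.natDegree = 2 ∧
      0 < f.leadingCoeff ∧ f.leadingCoeff ≤ M ∧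
      {t : ℕ | 0 < f.eval (t : ℤ) ∧ (f.eval (t : ℤ)).toNat.Prime}.Infinite := by
  obtain ⟨m, ν, hm, hmM, -, hd, hinf⟩ := (cofactorRung_infinite_iff M).mp h
  have hm' : (m : ℤ) ≠ 0 := by exact_mod_cast hm.ne'
  refine ⟨C (m : ℤ) * X ^ 2 + C ((2 * ν : ℕ) : ℤ) * X + C (((ν ^ 2 + 1) / m : ℕ) : ℤ),
    isBatemanHornSystem_cofactorPoly hm hd, natDegree_quadratic hm', ?_, ?_, ?_⟩
  · rw [leadingCoeff_quadratic hm']; exact_mod_cast hm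
  · rw [leadingCoeff_quadratic hm']; exact_mod_cast hmM
  · refine hinf.mono fun t ht ↦ ?_
    simp only [Set.mem_setOf_eq] at ht ⊢
    rw [eval_cofactorPoly, Int.toNat_natCast]
    exact ⟨by exact_mod_cast ht.pos, ht⟩

/-! ### The converse sanity direction: Conjecture F gives every rung -/

/-- Conjecture F (its instance `(a,b,c) = (1,0,1)`, Landau's problem) implies that every
bounded-cofactor rung is infinite. [folklore] -/
theorem cofactorRung_infinite_of_conjF (hF : HardyLittlewoodConjF) {M : ℕ} (hM : 0 < M) :
    {n : ℕ | ∃ m p : ℕ, 0 < m ∧ m ≤ M ∧ p.Prime ∧ n ^ 2 + 1 = m * p}.Infinite := by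
  have hinst := (hF 1 0 1 one_pos (by decide) (fun h ↦ Int.not_even_one h.2)
    (by rintro ⟨r, hr⟩; nlinarith [mul_self_nonneg r])).1
  -- `hinst : {p : ℕ | p.Prime ∧ ∃ t : ℕ, (p : ℤ) = 1 * t ^ 2 + 0 * t + 1}.Infinite`
  refine ((cofactorRung_infinite_iff M).mpr ⟨1, 0, one_pos, hM, one_pos, one_dvd _, ?_⟩)
  by_contra hfin
  refine hinst ((Set.Finite.image (fun t : ℕ ↦ t ^ 2 + 1) (Set.not_infinite.mp hfin)).subset ?_)
  rintro p ⟨hp, t, ht⟩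
  have hpt : p = t ^ 2 + 1 := by exact_mod_cast (by linear_combination ht : (p : ℤ) = t ^ 2 + 1)
  refine ⟨t, ?_, hpt.symm⟩
  simp only [Set.mem_setOf_eq]
  convert hp using 1
  rw [hpt]; simp

end Summit.Parity.BatemanHorn.Theorems
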